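import Summits.QuantumFields.BalabanUV.T4Continuum.Support.SubstrateFineFieldChartSUWindow
import Summits.QuantumFields.BalabanUV.T4Continuum.Support.SubstrateBlockAvgContinuity

/-!
# SUBSTRATE — W-24d RIDER «THE CANONICAL WINDOW AND ITS READING POINTS ARE INHABITED» (seat p2 gen 7; OFFER (O4), files only on the
# typer's number): non-vacuity of L-E18b PART 3 at the TRIVIAL FIELD and the ZERO DIRECTION, and the real foot of the chart at the centre

Cell `pub-balaban`, SUBSTRATE cell, seat `b2b-balaban-substrate-p2` (gen 7).  Summits-side under the LEAN PLACEMENT RULE; [folklore] over W-24d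
3a∕3b (`SubstrateFineFieldChartSU` p246261 ∕ `SubstrateFineFieldChartSUWindow` p246490), α (`SubstrateComplexAvgTower` p242952), W-24b, W-22′
(`chartAt_zero`) and the trivial-field lemmas of `SubstrateBackgroundDriven` §HavOne ∕ `SubstrateBlockAvgContinuity` BY NAME; nothing printed
asserted, no citation tags.  HONEST FRAMING: rung (B)+1 of the FINITE-VOLUME T⁴ programme — NOT infinite volume, NOT a mass gap, NOT Clay; spine
PROVED 0∕9.  NON-VACUITY ONLY: the canonical small-field window `smallWindow` of `FineFieldChart.canonicalSU ∕ balabanSU` contains the trivial field,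
the zero direction is admissible at every window field with positive radii, so the reading-point type `SlicePoint` is inhabited and the chart
reads the section of record at every window field (parameter `0`).  This says NOTHING about which non-trivial fields are small (levelwise `Small`
DEFINES the window) and is NOT the (0.4)–(0.7)-kind quantitative radius; NO estimate of any NE row; NE5 NOT PRINTED ∕ NOT PROVED.

WHAT IS HERE.  §1 (generic `G`, unitary `ι`, `ℰ.δ ≤ 1∕3`) the ZERO DIRECTION: `sliceR_zero_dir` ∕ `sliceS_zero_dir` (the slice is constant),
`towerSlice_zero_dir`, `towerCoord_zero_dir` (the coordinate vanishes identically), **`sliceControl_zero_dir`** (3a's displayed `SliceControl` HOLDS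
at `H = 0` for a levelwise-small centre and positive radii).  §2 (generic) the TRIVIAL FIELD is levelwise small: `small_iter_one`.  §3 (`SU(n)`):
**`one_mem_smallWindow`**, **`zero_mem_smallDirs`**, the centre reading point `SlicePoint.centre` with **`SlicePoint.emb_centre`** (`= chartAt _ ι U 0
= sectionOfRecord _ ι U`), `nonempty_slicePoint`, and at Bałaban's driven runs `one_mem_smallWindow_balaban` ∕ `nonempty_slicePoint_balaban`.
0 sorry; axioms ⊆ {propext, Classical.choice, Quot.sound}.
-/

noncomputable section

open scoped Matrix.Norms.L2Operator
open Set Metric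

namespace Summit.QuantumFields.BalabanUV.T4Continuum.SubstrateFineFieldChartSUNonempty

open Literature.MathematicalPhysics.QuantumFieldTheory.Balaban1983to89
open Literature.MathematicalPhysics.QuantumFieldTheory.Balaban1983to89.BlockAveraging (blockAvg Small)
open Literature.MathematicalPhysics.QuantumFieldTheory.Balaban1983to89.ExpMeanLog (eml expMeanLogSU)
open Literature.MathematicalPhysics.QuantumFieldTheory.Balaban1983to89.T4Continuum (T4Family)
open Literature.MathematicalPhysics.QuantumFieldTheory.Balaban1983to89.T4AdjointCovarianceUnitary (lieSU mem_lieSU_iff)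
open Literature.MathematicalPhysics.QuantumLattice (fundamentalRep fundamentalRep_mem_unitaryGroup)
open Summit.QuantumFields.BalabanUV.T4Continuum
open Summit.QuantumFields.BalabanUV.T4Continuum.SubstrateTransporterSpecies (towerDataOf)
open Summit.QuantumFields.BalabanUV.T4Continuum.SubstrateExpChartLog (norm_centre_window_lt_one)
open Summit.QuantumFields.BalabanUV.T4Continuum.SubstrateChartSection (sectionOfRecord)
open Summit.QuantumFields.BalabanUV.T4Continuum.SubstrateTwoRunsDriven (DrivenRuns)
open Summit.QuantumFields.BalabanUV.T4Continuum.SubstrateFineFieldChart (chartAt chartAt_zero FineFieldChart)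
open Summit.QuantumFields.BalabanUV.T4Continuum.SubstrateComplexBlockAvg
open Summit.QuantumFields.BalabanUV.T4Continuum.SubstrateComplexBlockAvgInv
open Summit.QuantumFields.BalabanUV.T4Continuum.SubstrateComplexAvgTower
open Summit.QuantumFields.BalabanUV.T4Continuum.SubstrateFineFieldChartSU
open Summit.QuantumFields.BalabanUV.T4Continuum.SubstrateFineFieldChartSUWindow
open Summit.QuantumFields.BalabanUV.T4Continuum.SubstrateBackgroundDriven (iter_one small_one_cfg)
open Summit.QuantumFields.BalabanUV.T4Continuum.SubstrateBlockAvgContinuity (blockAvg_expMeanLogSU_one)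

/-! ## §1 The zero direction -/

section ZeroDir

variable {P : Params} {o : Type*} [Fintype o] [DecidableEq o] {G : Type*} [GaugeGroup G]

/-- [folklore] Along the zero direction the `R`-side of the slice is the constant real field. -/
theorem sliceR_zero_dir (ι : G →* Matrix o o ℂ) (U : GaugeField P 0 G) (z : ℂ) :
    sliceR ι U (fun _ => (0 : Matrix o o ℂ)) z = fun b => ι (U b) := by
  funext b; simp [sliceR]

/-- [folklore] Along the zero direction the `S`-side of the slice is the constant real inverse field. -/
theorem sliceS_zero_dir (ι : G →* Matrix o o ℂ) (U : GaugeField P 0 G) (z : ℂ) :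
    sliceS ι U (fun _ => (0 : Matrix o o ℂ)) z = fun b => ι (U b)⁻¹ := by
  funext b; simp [sliceS]

/-- [folklore] Along the zero direction the two-sided tower of the slice is the tower at `z = 0`. -/
theorem towerSlice_zero_dir (ι : G →* Matrix o o ℂ) (U : GaugeField P 0 G) (z : ℂ) :
    towerSlice P ι U (fun _ => (0 : Matrix o o ℂ)) z = towerRS P (fun b => ι (U b), fun b => ι (U b)⁻¹) := by
  rw [towerSlice, sliceR_zero_dir, sliceS_zero_dir]

variable (ℰ : LoopAverage G) (hδ : ℰ.δ ≤ 1 / 3) {ι : G →* Matrix o o ℂ} (hι : ∀ g, ι g ∈ Matrix.unitaryGroup o ℂ)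
  (hdist : ∀ g : G, ‖ι g - 1‖ = dist1 g) (hE : ∀ {m : ℕ} (W : Fin (m + 1) → G), (∀ i, dist1 (W i) < ℰ.δ) → ι (ℰ.E W) = eml fun i => ι (W i))
  {U : GaugeField P 0 G} (hsmall : ∀ j < P.K, ∀ c, Small ℰ (Averaging.iter (fun _ => blockAvg ℰ) j U) c)
include hδ hι hdist hE hsmall

/-- [folklore] **ALONG THE ZERO DIRECTION THE TOWER CHART COORDINATE VANISHES IDENTICALLY** (α `towerCoord_zero` at every `z`). -/
theorem towerCoord_zero_dir (z : ℂ) : towerCoord P ℰ ι U (fun _ => (0 : Matrix o o ℂ)) z = 0 := by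
  have h : towerCoord P ℰ ι U (fun _ => (0 : Matrix o o ℂ)) z = towerCoord P ℰ ι U (fun _ => (0 : Matrix o o ℂ)) 0 := by
    simp only [towerCoord, towerSlice_zero_dir]
  rw [h]; exact towerCoord_zero ℰ hδ ι hι hdist hE U _ hsmall

/-- [folklore] **3a's DISPLAYED `SliceControl` HOLDS AT THE ZERO DIRECTION** for a levelwise-small centre and positive radii: (`loop`) the
iterated loop variables of the constant slice are the real ones (α `iterRS_hom_eq`, W-24b `loopHolRS_hom_eq` ∕ α1 `loopHolSR_hom_eq`, `hdist`);
(`window`) the `R`-tower is the tower of record (α `towerRS_hom_eq_fst`, W-24a `norm_centre_window_lt_one`); (`depth`) `towerCoord_zero_dir`. -/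
theorem sliceControl_zero_dir {ϱ : ℕ → ℝ} (hϱ : ∀ k, 0 < ϱ k) : SliceControl ℰ ι U (fun _ => (0 : Matrix o o ℂ)) ϱ where
  loop z _ j hj c i := by
    rw [sliceR_zero_dir, sliceS_zero_dir, iterRS_hom_eq ℰ hδ ι hdist hE U j fun j' hj' => hsmall j' (hj'.trans hj)]
    dsimp only
    rw [loopHolRS_hom_eq, loopHolSR_hom_eq, hdist, hdist, GaugeGroup.dist1_inv]
    exact ⟨hsmall j hj c i, hsmall j hj c i⟩
  window z _ k ν i := by
    rw [towerSlice_zero_dir, towerRS_hom_eq_fst ℰ hδ ι hdist hE U hsmall]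
    exact norm_centre_window_lt_one P (fun k ν i => Matrix.UnitaryGroup.det_isUnit ⟨_, towerDataOf_mem_unitaryGroup ℰ hι U k ν i⟩) k ν i
  depth k z _ := by rw [towerCoord_zero_dir ℰ hδ hι hdist hE hsmall z, norm_zero]; exact hϱ k

end ZeroDir

/-! ## §2 The trivial field is levelwise small -/

section One

variable {P : Params} {G : Type*} [GaugeGroup G] (ℰ : LoopAverage G)

/-- [folklore] **THE TRIVIAL FIELD IS SMALL AT EVERY LEVEL OF ITS AVERAGING TOWER** when the average is normalised at identity families
(`(blockAvg ℰ).avg 1 = 1` at every level: `SubstrateBackgroundDriven.iter_one` + `small_one_cfg`). -/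
theorem small_iter_one (hav1 : ∀ j, (blockAvg (P := P) (j := j) ℰ).avg 1 = 1) (j : ℕ) (c : PBond P (j + 1)) :
    Small ℰ (Averaging.iter (fun _ => blockAvg ℰ) j (1 : GaugeField P 0 G)) c := by
  rw [iter_one (fun _ => blockAvg ℰ) hav1 j]; exact small_one_cfg ℰ c

end One

/-! ## §3 `SU(n)`: the canonical window, the zero direction, the centre reading point -/

section SU

variable {n : Type} [Fintype n] [DecidableEq n] [Nonempty n] {D : DrivenRuns (Matrix.specialUnitaryGroup n ℂ)}
  {ϱ : ℕ → D.carriers.BgB → ℝ} {r : ℝ}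

omit [DecidableEq n] [Nonempty n] in
/-- [folklore] `0 ∈ 𝔰𝔲(n)`. -/
theorem zero_mem_lieSU : (0 : Matrix n n ℂ) ∈ lieSU n := by
  rw [mem_lieSU_iff]; exact ⟨by rw [star_zero, neg_zero], Matrix.trace_zero n ℂ⟩

/-- [folklore] **THE TRIVIAL FIELD IS IN THE CANONICAL WINDOW** (whenever it is admissible in run B). -/
theorem one_mem_smallWindow (h1 : (1 : GaugeField (D.F.P (D.K + 1)) 0 (Matrix.specialUnitaryGroup n ℂ)) ∈ D.admB) :
    (⟨1, h1⟩ : D.carriers.BgB) ∈ smallWindow D :=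
  fun j _ c => small_iter_one (expMeanLogSU (n := n)) (fun j => blockAvg_expMeanLogSU_one _ j) j c

/-- [folklore] **THE ZERO DIRECTION IS ADMISSIBLE AT EVERY WINDOW FIELD WITH POSITIVE RADII** (§1 `sliceControl_zero_dir` at `SU(n)`). -/
theorem zero_mem_smallDirs {U : D.carriers.BgB} (hU : U ∈ smallWindow D) (hϱ : ∀ k, 0 < ϱ k U) :
    (fun _ => (0 : Matrix n n ℂ)) ∈ smallDirs D ϱ U :=
  ⟨fun _ => zero_mem_lieSU,
    sliceControl_zero_dir (expMeanLogSU (n := n)) expMeanLogSU_δ_le_third (fun g => fundamentalRep_mem_unitaryGroup g) (fun _ => rfl)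
      (fun W hW => fundamentalRep_expMeanLogSU_E W hW) hU hϱ⟩

/-- [folklore] **THE CENTRE READING POINT** of a window field with positive radii (zero direction, parameter `0`; `0 ≤ r`). -/
def SlicePoint.centre (U : D.carriers.BgB) (hU : U ∈ smallWindow D) (hϱ : ∀ k, 0 < ϱ k U) (hr : 0 ≤ r) :
    SlicePoint D (smallWindow D) (smallDirs D ϱ) r where
  ctr := U
  ctr_mem := hU
  dir := fun _ => 0
  dir_mem := zero_mem_smallDirs hU hϱ
  param := 0
  norm_param_le := by rw [norm_zero]; exact hr

/-- [folklore] **THE CHART READS THE SECTION OF RECORD AT THE CENTRE READING POINT**: `SlicePoint.emb (centre U …) = chartAt _ ι U 0 =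
sectionOfRecord _ ι U` (§1 `towerCoord_zero_dir`, W-22′ `chartAt_zero`) — an END concluded over `SlicePoint`s reads back at every real window field. -/
theorem SlicePoint.emb_centre (U : D.carriers.BgB) (hU : U ∈ smallWindow D) (hϱ : ∀ k, 0 < ϱ k U) (hr : 0 ≤ r) :
    SlicePoint.emb D (fundamentalRep n) (expMeanLogSU (n := n)) (SlicePoint.centre U hU hϱ hr) = sectionOfRecord D (fundamentalRep n) U := by
  rw [SlicePoint.emb, ← chartAt_zero]
  exact congrArg _ (towerCoord_zero_dir (expMeanLogSU (n := n)) expMeanLogSU_δ_le_third (fun g => fundamentalRep_mem_unitaryGroup g)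
    (fun _ => rfl) (fun W hW => fundamentalRep_expMeanLogSU_E W hW) hU 0)

/-- [folklore] **THE READING-POINT TYPE IS INHABITED** as soon as the trivial field is admissible, its radii are positive and `0 ≤ r`. -/
theorem nonempty_slicePoint (h1 : (1 : GaugeField (D.F.P (D.K + 1)) 0 (Matrix.specialUnitaryGroup n ℂ)) ∈ D.admB)
    (hϱ : ∀ k, 0 < ϱ k ⟨1, h1⟩) (hr : 0 ≤ r) : Nonempty (SlicePoint D (smallWindow D) (smallDirs D ϱ) r) :=
  ⟨SlicePoint.centre _ (one_mem_smallWindow h1) hϱ hr⟩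

/-- [folklore] **AT BAŁABAN's DRIVEN RUNS** (`admB = univ`): the trivial field is in the canonical window of `FineFieldChart.balabanSU`. -/
theorem one_mem_smallWindow_balaban (F : T4Family) (K m' : ℕ)
    (bgA : Background (F.P K) (Matrix.specialUnitaryGroup n ℂ) (fun j => blockAvg (j := j) (expMeanLogSU (n := n))))
    (bgB : Background (F.P (K + 1)) (Matrix.specialUnitaryGroup n ℂ) (fun j => blockAvg (j := j) (expMeanLogSU (n := n)))) (gA gB : ℕ → ℝ) :
    (⟨1, Set.mem_univ _⟩ : (DrivenRuns.balaban F K m' (expMeanLogSU (n := n)) bgA bgB gA gB).carriers.BgB) ∈ smallWindow _ :=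
  one_mem_smallWindow (D := DrivenRuns.balaban F K m' (expMeanLogSU (n := n)) bgA bgB gA gB) (Set.mem_univ _)

/-- [folklore] … so the reading points of `FineFieldChart.balabanSU … ϱ r` are INHABITED for radii positive at the trivial field and `0 ≤ r`. -/
theorem nonempty_slicePoint_balaban (F : T4Family) (K m' : ℕ)
    (bgA : Background (F.P K) (Matrix.specialUnitaryGroup n ℂ) (fun j => blockAvg (j := j) (expMeanLogSU (n := n))))
    (bgB : Background (F.P (K + 1)) (Matrix.specialUnitaryGroup n ℂ) (fun j => blockAvg (j := j) (expMeanLogSU (n := n)))) (gA gB : ℕ → ℝ)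
    {ϱ : ℕ → (DrivenRuns.balaban F K m' (expMeanLogSU (n := n)) bgA bgB gA gB).carriers.BgB → ℝ} {r : ℝ}
    (hϱ : ∀ k, 0 < ϱ k ⟨1, Set.mem_univ _⟩) (hr : 0 ≤ r) :
    Nonempty (SlicePoint (DrivenRuns.balaban F K m' (expMeanLogSU (n := n)) bgA bgB gA gB) (smallWindow _) (smallDirs _ ϱ) r) :=
  nonempty_slicePoint (D := DrivenRuns.balaban F K m' (expMeanLogSU (n := n)) bgA bgB gA gB) (Set.mem_univ _) hϱ hr

end SU

end Summit.QuantumFields.BalabanUV.T4Continuum.SubstrateFineFieldChartSUNonempty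

end
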